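import Mathlib
import HarnessLib
import Literature.Combinatorics.Additive.Pollard
import Literature.Combinatorics.Additive.Kneser
import Literature.Combinatorics.Additive.GrynkiewiczPollardRep
import Literature.Combinatorics.Additive.GrynkiewiczPollardKneserTools

/-!
# Grynkiewicz's extension of Pollard's theorem — port, part III: the structural alternative and STEP 1

Topic: `Literature/Combinatorics/Additive`.  Third file of the port of [Gry10] Theorem 1.1 / 1.2.

* `Grynkiewicz.Str t A B A′ B′` — the structural alternative (7)+(8) of [Gry10]: `A′ ⊆ A`, `B′ ⊆ B`,
  `l = |A ∖ A′| + |B ∖ B′| ≤ t − 1`, and `A′ +_t B′ = A′ + B′ = A +_t B` (every element of `A′ + B′` has `≥ t`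
  representations in `A′ + B′`, every `t`-popular sum of `A + B` lies in `A′ + B′`);
* `Grynkiewicz.Goal t c A B` — "(P) `t(|A|+|B|) ≤ N_t(A,B) + c` or `∃ A′ B′, Str`", the statement proved by
  induction (`c = 4` for `t = 2`, `c = 2t² − 1` for `t ≥ 3`);
* symmetry and translation invariance of `Str`/`Goal`, saturation of `A′, B′` by the stabilizer
  `H = stab(A′ + B′)`;
* **STEP 1** of [Gry10] §2: from `Str` (saturated) either `t(|A|+|B|) ≤ N_t + t²`, or the pair `A′, B′` is
  Kneser-tight with `|H| ≥ ρ + t + 1` and `N_t(A,B) = t|A′+B′| + #{(a,b) : a + b ∉ A′+B′}` with at least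
  `l(|H| − ρ)` such pairs — the stabilizer bound (9).

## References
* D. J. Grynkiewicz, *On extending Pollard's theorem for t-representable sums*, Israel J. Math. 177 (2010)
  413–439 (arXiv:0803.2601), §2 Step 1 [cite: Grynkiewicz2010, Thm 1.1].
-/

namespace Literature.Combinatorics.Additive

namespace Grynkiewicz

open Finset Pollard
open scoped Pointwise

variable {G : Type*} [AddCommGroup G] [DecidableEq G]

/-! ### The structural alternative and the goal of the induction -/

/-- The structural alternative (7)+(8) of [Gry10] Thm 1.1 for a pair `(A,B)` witnessed by `(A′,B′)`:
`A′ ⊆ A`, `B′ ⊆ B`, `|A ∖ A′| + |B ∖ B′| + 1 ≤ t`, every element of `A′ + B′` has at least `t`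
representations in `A′ + B′`, and every element with at least `t` representations in `A + B` lies in
`A′ + B′` (so `A′ +_t B′ = A′ + B′ = A +_t B`). [cite: Grynkiewicz2010, Thm 1.1] -/
def Str (t : ℕ) (A B A' B' : Finset G) : Prop :=
  A' ⊆ A ∧ B' ⊆ B ∧ (A \ A').card + (B \ B').card + 1 ≤ t ∧
    (∀ w ∈ A' + B', t ≤ rep A' B' w) ∧ ∀ w, t ≤ rep A B w → w ∈ A' + B'

/-- The dichotomy proved by induction: the Pollard-type bound `t(|A| + |B|) ≤ N_t(A,B) + c`, or the
structural alternative. [cite: Grynkiewicz2010, Thm 1.1] -/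
def Goal (t c : ℕ) (A B : Finset G) : Prop :=
  t * (A.card + B.card) ≤ NS t A B + c ∨ ∃ A' B' : Finset G, Str t A B A' B'

section StrBasic

variable {t : ℕ} {A B A' B' : Finset G}

/-- `Str` is symmetric in the two coordinates. [cite: Grynkiewicz2010, Thm 1.1] -/
theorem Str.symm (h : Str t A B A' B') : Str t B A B' A' := by
  obtain ⟨hA, hB, hl, hpop, hin⟩ := h
  refine ⟨hB, hA, by omega, fun w hw => ?_, fun w hw => ?_⟩
  · rw [add_comm] at hw; rw [rep_comm]; exact hpop w hw
  · rw [add_comm]; rw [rep_comm] at hw; exact hin w hw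

/-- `Goal` is symmetric. [cite: Grynkiewicz2010, Thm 1.1] -/
theorem Goal.symm {c : ℕ} (h : Goal t c A B) : Goal t c B A := by
  rcases h with h | ⟨A', B', h⟩
  · left; rw [NS_comm, add_comm B.card]; exact h
  · exact Or.inr ⟨B', A', h.symm⟩

/-- The trivial structure when every sum is `t`-popular: `Str t A B A B`. [cite: Grynkiewicz2010, §2 Step 1] -/
theorem Str.of_popular (ht : 1 ≤ t) (h : ∀ w ∈ A + B, t ≤ rep A B w) : Str t A B A B :=
  ⟨Subset.refl _, Subset.refl _, by simpa using ht, h, fun _ hw => mem_add_of_le_rep ht hw⟩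

/-- Under `Str`, the witnesses are nonempty when `|A|, |B| ≥ t`. [cite: Grynkiewicz2010, §2 Step 1] -/
theorem Str.nonempty (h : Str t A B A' B') (hA : t ≤ A.card) (hB : t ≤ B.card) :
    A'.Nonempty ∧ B'.Nonempty := by
  obtain ⟨hA', hB', hl, -, -⟩ := h
  have h1 := card_sdiff_add_card_eq_card hA'
  have h2 := card_sdiff_add_card_eq_card hB'
  constructor
  · rw [← card_pos]; omega
  · rw [← card_pos]; omega

/-- Under `Str`, `A′ + B′ ⊆ A + B`. [cite: Grynkiewicz2010, §2 Step 1] -/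
theorem Str.add_subset (h : Str t A B A' B') : A' + B' ⊆ A + B := add_subset_add h.1 h.2.1

/-- Under `Str`, `r_{A,B} ≥ t` exactly on `A′ + B′`. [cite: Grynkiewicz2010, §2 Step 1] -/
theorem Str.le_rep_iff (h : Str t A B A' B') (w : G) : t ≤ rep A B w ↔ w ∈ A' + B' :=
  ⟨h.2.2.2.2 w, fun hw => (h.2.2.2.1 w hw).trans (rep_mono h.1 h.2.1 w)⟩

/-- If `r_{A,B} ≥ t` on `A′ + B′ ⊆ A + B` and `r_{A,B} ≤ t` off `A′ + B′`, then
`N_t(A,B) = t |A′ + B′| + #{(a,b) ∈ A × B : a + b ∉ A′ + B′}`. [cite: Grynkiewicz2010, §2 Step 1] -/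
theorem NS_eq_of_threshold {C : Finset G} (hsub : C ⊆ A + B) (hge : ∀ w ∈ C, t ≤ rep A B w)
    (hle : ∀ w ∈ A + B, w ∉ C → rep A B w ≤ t) :
    NS t A B = t * C.card + ((A ×ˢ B).filter (fun p => p.1 + p.2 ∉ C)).card := by
  unfold NS
  rw [← sum_filter_add_sum_filter_not (A + B) (fun w => w ∈ C)]
  congr 1
  · rw [sum_const_nat (m := t) (fun w hw => min_eq_left (hge w (mem_filter.1 hw).2)), mul_comm,
      filter_mem_eq_inter, inter_eq_right.2 hsub]
  · rw [card_eq_sum_card_fiberwise (f := fun p : G × G => p.1 + p.2) (t := (A + B).filter (· ∉ C))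
      (s := (A ×ˢ B).filter (fun p => p.1 + p.2 ∉ C))]
    · refine sum_congr rfl fun w hw => ?_
      rw [min_eq_right (hle w (mem_filter.1 hw).1 (mem_filter.1 hw).2), rep_def]
      congr 1
      ext p
      simp only [mem_filter, mem_product]
      constructor
      · rintro ⟨hp, he⟩; exact ⟨⟨hp, by rw [he]; exact (mem_filter.1 hw).2⟩, he⟩
      · rintro ⟨⟨hp, _⟩, he⟩; exact ⟨hp, he⟩
    · intro p hp
      have hp' := mem_filter.1 (mem_coe.1 hp)
      exact mem_coe.2 (mem_filter.2 ⟨add_mem_add (mem_product.1 hp'.1).1 (mem_product.1 hp'.1).2, hp'.2⟩)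

/-- Under `Str`, `N_t(A,B) = t |A′ + B′| + #{(a,b) ∈ A × B : a + b ∉ A′ + B′}`.
[cite: Grynkiewicz2010, §2 Step 1] -/
theorem Str.NS_eq (h : Str t A B A' B') :
    NS t A B = t * (A' + B').card + ((A ×ˢ B).filter (fun p => p.1 + p.2 ∉ A' + B')).card :=
  NS_eq_of_threshold h.add_subset (fun w hw => (h.le_rep_iff w).2 hw)
    (fun _ _ hw => ((rep_le_card_sdiff_add hw).trans (Nat.le_succ _)).trans h.2.2.1)

/-- Translation: `Str` for `(A, x + B)` gives `Str` for `(A, B)`. [cite: Grynkiewicz2010, §2 Step 4] -/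
theorem Str.of_vadd_right {x : G} {B'' : Finset G} (h : Str t A (x +ᵥ B) A' B'') :
    Str t A B A' ((-x) +ᵥ B'') := by
  obtain ⟨hA, hB, hl, hpop, hin⟩ := h
  have hBsub : (-x) +ᵥ B'' ⊆ B := by
    intro b hb
    obtain ⟨b'', hb'', rfl⟩ := mem_vadd_finset.1 hb
    obtain ⟨b0, hb0, rfl⟩ := mem_vadd_finset.1 (hB hb'')
    simpa using hb0
  have hcard : (B \ ((-x) +ᵥ B'')).card = ((x +ᵥ B) \ B'').card := by
    have e : (x +ᵥ B) \ B'' = x +ᵥ (B \ ((-x) +ᵥ B'')) := by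
      rw [vadd_finset_sdiff, vadd_vadd, add_neg_cancel, zero_vadd]
    rw [e, card_vadd_finset]
  refine ⟨hA, hBsub, by rw [hcard]; exact hl, fun w hw => ?_, fun w hw => ?_⟩
  · rw [rep_vadd_right, sub_neg_eq_add]
    rw [add_vadd_finset, mem_vadd_finset] at hw
    obtain ⟨v, hv, rfl⟩ := hw
    have := hpop v hv
    simpa using this
  · rw [add_vadd_finset, mem_vadd_finset]
    refine ⟨w + x, hin _ ?_, by rw [vadd_eq_add]; abel⟩
    rw [rep_vadd_right, add_sub_cancel_right]; exact hw

/-- Translation: `Goal` for `(A, x + B)` gives `Goal` for `(A, B)`. [cite: Grynkiewicz2010, §2 Step 4] -/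
theorem Goal.of_vadd_right {c : ℕ} {x : G} (h : Goal t c A (x +ᵥ B)) : Goal t c A B := by
  rcases h with h | ⟨A', B'', h⟩
  · left; rwa [NS_vadd_right, card_vadd_finset] at h
  · exact Or.inr ⟨A', _, h.of_vadd_right⟩

end StrBasic

/-! ### Saturation by the stabilizer of `A′ + B′` -/

section Sat

variable {t : ℕ} {A B A' B' : Finset G}

/-- `A′` is saturated in `A` with respect to `H`: every element of `A` in the `H`-hull of `A′` is in `A′`.
[cite: Grynkiewicz2010, §2 Step 1] -/
def Sat (A A' H : Finset G) : Prop := ∀ a ∈ A, a ∈ A' + H → a ∈ A'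

/-- Saturating `A′, B′` by `H = stab(A′ + B′)` preserves `Str`, keeps `A′ + B′`, and yields saturated
witnesses. [cite: Grynkiewicz2010, §2 Step 1] -/
theorem Str.saturate (h : Str t A B A' B') (hA' : A'.Nonempty) (hB' : B'.Nonempty) :
    ∃ A'' B'' : Finset G, Str t A B A'' B'' ∧ A'' + B'' = A' + B' ∧ A' ⊆ A'' ∧ B' ⊆ B'' ∧
      Sat A A'' (A' + B').addStab ∧ Sat B B'' (A' + B').addStab := by
  obtain ⟨hA, hB, hl, hpop, hin⟩ := h
  set H := (A' + B').addStab with hH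
  have hSne : (A' + B').Nonempty := hA'.add hB'
  have hper : A' + B' + H = A' + B' := add_addStab _
  refine ⟨A.filter (· ∈ A' + H), B.filter (· ∈ B' + H), ?_, ?_, ?_, ?_, ?_, ?_⟩
  · -- the sumset is unchanged
    have hsum : A.filter (· ∈ A' + H) + B.filter (· ∈ B' + H) = A' + B' := by
      apply Subset.antisymm
      · intro w hw
        obtain ⟨a, ha, b, hb, rfl⟩ := mem_add.1 hw
        obtain ⟨a', ha', h1, hh1, rfl⟩ := mem_add.1 (mem_filter.1 ha).2
        obtain ⟨b', hb', h2, hh2, rfl⟩ := mem_add.1 (mem_filter.1 hb).2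
        have e : a' + h1 + (b' + h2) = (a' + b') + (h1 + h2) := by abel
        rw [e, ← hper]
        exact add_mem_add (add_mem_add ha' hb') (add_mem_addStab hh1 hh2)
      · exact add_subset_add
          (fun a ha => mem_filter.2 ⟨hA ha, subset_add_addStab hSne A' ha⟩)
          (fun b hb => mem_filter.2 ⟨hB hb, subset_add_addStab hSne B' hb⟩)
    refine ⟨filter_subset _ _, filter_subset _ _, ?_, ?_, ?_⟩
    · have h1 : (A \ A.filter (· ∈ A' + H)).card ≤ (A \ A').card :=
        card_le_card (sdiff_subset_sdiff (Subset.refl _)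
          fun a ha => mem_filter.2 ⟨hA ha, subset_add_addStab hSne A' ha⟩)
      have h2 : (B \ B.filter (· ∈ B' + H)).card ≤ (B \ B').card :=
        card_le_card (sdiff_subset_sdiff (Subset.refl _)
          fun b hb => mem_filter.2 ⟨hB hb, subset_add_addStab hSne B' hb⟩)
      omega
    · intro w hw
      rw [hsum] at hw
      exact (hpop w hw).trans (rep_mono
        (fun a ha => mem_filter.2 ⟨hA ha, subset_add_addStab hSne A' ha⟩)
        (fun b hb => mem_filter.2 ⟨hB hb, subset_add_addStab hSne B' hb⟩) w)
    · intro w hw; rw [hsum]; exact hin w hw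
  · apply Subset.antisymm
    · intro w hw
      obtain ⟨a, ha, b, hb, rfl⟩ := mem_add.1 hw
      obtain ⟨a', ha', h1, hh1, rfl⟩ := mem_add.1 (mem_filter.1 ha).2
      obtain ⟨b', hb', h2, hh2, rfl⟩ := mem_add.1 (mem_filter.1 hb).2
      have e : a' + h1 + (b' + h2) = (a' + b') + (h1 + h2) := by abel
      rw [e, ← hper]
      exact add_mem_add (add_mem_add ha' hb') (add_mem_addStab hh1 hh2)
    · exact add_subset_add
        (fun a ha => mem_filter.2 ⟨hA ha, subset_add_addStab hSne A' ha⟩)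
        (fun b hb => mem_filter.2 ⟨hB hb, subset_add_addStab hSne B' hb⟩)
  · exact fun a ha => mem_filter.2 ⟨hA ha, subset_add_addStab hSne A' ha⟩
  · exact fun b hb => mem_filter.2 ⟨hB hb, subset_add_addStab hSne B' hb⟩
  · intro a ha haH
    refine mem_filter.2 ⟨ha, ?_⟩
    have : A.filter (· ∈ A' + H) + H ⊆ A' + H :=
      (add_subset_add_right (fun x hx => (mem_filter.1 hx).2)).trans (add_addStab_add_addStab A').subset
    exact this haH
  · intro b hb hbH
    refine mem_filter.2 ⟨hb, ?_⟩
    have : B.filter (· ∈ B' + H) + H ⊆ B' + H :=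
      (add_subset_add_right (fun x hx => (mem_filter.1 hx).2)).trans (add_addStab_add_addStab B').subset
    exact this hbH

end Sat

/-! ### STEP 1: the stabilizer bound -/

section StepOne

variable {t : ℕ} {A B A' B' : Finset G}

/-- Pairs with sum outside `A′ + B′`, counted over a fixed first coordinate `a ∉ A′ + H`: at least
`|H| − ρ_{B′}` of them (Lemma 2.2 plus the coset–hole count), for a Kneser-tight pair. [cite: Grynkiewicz2010, §2 Step 1] -/
theorem card_filter_add_not_mem_ge_left (hA' : A'.Nonempty) (hB' : B'.Nonempty)
    (htight : (A' + B').card + (A' + B').addStab.card =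
      (A' + (A' + B').addStab).card + (B' + (A' + B').addStab).card)
    {a : G} (ha : a ∉ A' + (A' + B').addStab) :
    (A' + B').addStab.card ≤ (B'.filter (fun b => a + b ∉ A' + B')).card +
      ((B' + (A' + B').addStab).card - B'.card) := by
  have hSne : (A' + B').Nonempty := hA'.add hB'
  have hper : A' + B' + (A' + B').addStab = A' + B' := add_addStab _
  obtain ⟨b', hb', hout⟩ := exists_add_not_mem_of_not_mem_add_addStab hA' hB' htight ha
  -- the whole coset `B' ∩ (b' + H)` gives sums outside
  have hsub : B' ∩ (b' +ᵥ (A' + B').addStab) ⊆ B'.filter (fun b => a + b ∉ A' + B') := by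
    intro b hb
    rw [mem_inter, mem_coset_iff] at hb
    refine mem_filter.2 ⟨hb.1, fun hin => hout ?_⟩
    have e : a + b' = (a + b) + -(b - b') := by abel
    rw [e, ← hper]
    exact add_mem_add hin (neg_mem_addStab hb.2)
  have := card_addStab_le_card_inter_coset_add_holes hSne hb' (S := A' + B')
  have h2 := card_le_card hsub
  omega

/-- The pair count behind the stabilizer bound (9): for `A′ ⊆ A`, `B′ ⊆ B` nonempty, Kneser-tight, and
saturated by `H = stab(A′ + B′)`, at least `(|A ∖ A′| + |B ∖ B′|)(|H| − ρ)` pairs `(a,b) ∈ A × B` have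
`a + b ∉ A′ + B′` (each deleted element contributes a whole coset of partners, by Lemma 2.2).
[cite: Grynkiewicz2010, §2 Step 1] -/
theorem pairs_outside_ge (hA'A : A' ⊆ A) (hB'B : B' ⊆ B) (hA' : A'.Nonempty) (hB' : B'.Nonempty)
    (htight : (A' + B').card + (A' + B').addStab.card =
      (A' + (A' + B').addStab).card + (B' + (A' + B').addStab).card)
    (hsA : Sat A A' (A' + B').addStab) (hsB : Sat B B' (A' + B').addStab) :
    ((A \ A').card + (B \ B').card) *
        ((A' + B').addStab.card -
          (((A' + (A' + B').addStab).card - A'.card) + ((B' + (A' + B').addStab).card - B'.card))) ≤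
      ((A ×ˢ B).filter (fun p => p.1 + p.2 ∉ A' + B')).card := by
  set H := (A' + B').addStab with hH
  set l := (A \ A').card + (B \ B').card with hl
  set ρ := ((A' + H).card - A'.card) + ((B' + H).card - B'.card) with hρ
  have hSne : (A' + B').Nonempty := hA'.add hB'
  have hρA : A'.card ≤ (A' + H).card := card_le_card_add_addStab hSne A'
  have hρB : B'.card ≤ (B' + H).card := card_le_card_add_addStab hSne B'
  -- split the pairs by whether the first coordinate is in `A'`
  have hsplit : ((A \ A') ×ˢ B).filter (fun p => p.1 + p.2 ∉ A' + B') ∪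
      (A' ×ˢ (B \ B')).filter (fun p => p.1 + p.2 ∉ A' + B') ⊆
      (A ×ˢ B).filter (fun p => p.1 + p.2 ∉ A' + B') := by
    intro p hp
    rw [mem_filter, mem_product]
    rcases mem_union.1 hp with hp | hp
    · rw [mem_filter, mem_product, mem_sdiff] at hp
      exact ⟨⟨hp.1.1.1, hp.1.2⟩, hp.2⟩
    · rw [mem_filter, mem_product, mem_sdiff] at hp
      exact ⟨⟨hA'A hp.1.1, hp.1.2.1⟩, hp.2⟩
  have hdisj : Disjoint (((A \ A') ×ˢ B).filter (fun p => p.1 + p.2 ∉ A' + B'))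
      ((A' ×ˢ (B \ B')).filter (fun p => p.1 + p.2 ∉ A' + B')) := by
    rw [disjoint_left]
    intro p hp hp'
    rw [mem_filter, mem_product, mem_sdiff] at hp hp'
    exact hp.1.1.2 hp'.1.1
  -- first family: fiberwise over `a ∈ A \ A'`
  have hfam1 : (A \ A').card * (H.card - ρ) ≤
      (((A \ A') ×ˢ B).filter (fun p => p.1 + p.2 ∉ A' + B')).card := by
    rw [card_eq_sum_card_fiberwise (f := fun p : G × G => p.1) (t := A \ A')
      (fun p hp => mem_coe.2 (mem_product.1 (mem_filter.1 (mem_coe.1 hp)).1).1)]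
    rw [← smul_eq_mul, ← sum_const]
    refine sum_le_sum fun a ha => ?_
    have haH : a ∉ A' + H := fun haH => (mem_sdiff.1 ha).2 (hsA a (mem_sdiff.1 ha).1 haH)
    have hb := card_filter_add_not_mem_ge_left hA' hB' htight haH
    rw [← hH] at hb
    have hle : (B'.filter (fun b => a + b ∉ A' + B')).card ≤
        ((((A \ A') ×ˢ B).filter (fun p => p.1 + p.2 ∉ A' + B')).filter (fun p => p.1 = a)).card := by
      have hinj : Set.InjOn (fun b : G => (a, b)) ↑(B'.filter (fun b => a + b ∉ A' + B')) :=
        fun b _ b' _ e => (Prod.mk.inj e).2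
      rw [← card_image_of_injOn hinj]
      refine card_le_card fun p hp => ?_
      obtain ⟨b, hb, rfl⟩ := mem_image.1 hp
      rw [mem_filter] at hb
      rw [mem_filter, mem_filter, mem_product]
      exact ⟨⟨⟨ha, hB'B hb.1⟩, hb.2⟩, rfl⟩
    omega
  -- second family: fiberwise over `b ∈ B \ B'` (symmetric)
  have hfam2 : (B \ B').card * (H.card - ρ) ≤
      ((A' ×ˢ (B \ B')).filter (fun p => p.1 + p.2 ∉ A' + B')).card := by
    rw [card_eq_sum_card_fiberwise (f := fun p : G × G => p.2) (t := B \ B')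
      (fun p hp => mem_coe.2 (mem_product.1 (mem_filter.1 (mem_coe.1 hp)).1).2)]
    rw [← smul_eq_mul, ← sum_const]
    refine sum_le_sum fun b hb => ?_
    have hbH : b ∉ B' + H := fun hbH => (mem_sdiff.1 hb).2 (hsB b (mem_sdiff.1 hb).1 hbH)
    have e : B' + A' = A' + B' := add_comm B' A'
    have htight' : (B' + A').card + (B' + A').addStab.card =
        (B' + (B' + A').addStab).card + (A' + (B' + A').addStab).card := by
      rw [e, ← hH]; omega
    have hbH' : b ∉ B' + (B' + A').addStab := by rw [e]; exact hbH
    have ha := card_filter_add_not_mem_ge_left hB' hA' htight' hbH'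
    rw [e, ← hH] at ha
    have hle : (A'.filter (fun a => b + a ∉ A' + B')).card ≤
        (((A' ×ˢ (B \ B')).filter (fun p => p.1 + p.2 ∉ A' + B')).filter (fun p => p.2 = b)).card := by
      have hinj : Set.InjOn (fun a : G => (a, b)) ↑(A'.filter (fun a => b + a ∉ A' + B')) :=
        fun a _ a' _ e => (Prod.mk.inj e).1
      rw [← card_image_of_injOn hinj]
      refine card_le_card fun p hp => ?_
      obtain ⟨a, ha', rfl⟩ := mem_image.1 hp
      rw [mem_filter] at ha'
      rw [mem_filter, mem_filter, mem_product]
      exact ⟨⟨⟨ha'.1, hb⟩, by rw [add_comm a b]; exact ha'.2⟩, rfl⟩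
    omega
  calc l * (H.card - ρ) = (A \ A').card * (H.card - ρ) + (B \ B').card * (H.card - ρ) := by
        rw [hl]; ring
    _ ≤ _ := Nat.add_le_add hfam1 hfam2
    _ = _ := (card_union_of_disjoint hdisj).symm
    _ ≤ _ := card_le_card hsplit

/-- **STEP 1 of [Gry10] §2.**  Let `Str t A B A′ B′` hold with `A′, B′` nonempty and saturated by
`H = stab(A′ + B′)`, `l = |A ∖ A′| + |B ∖ B′|`, `ρ = |A′ + H| − |A′| + |B′ + H| − |B′|`.  Then either
`t(|A| + |B|) ≤ N_t(A,B) + t²`, or: the pair `(A′, B′)` is Kneser-tight, `|H| ≥ ρ + t + 1`, and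
`N_t(A,B) ≥ t|A′ + B′| + l(|H| − ρ)` where `t|A′ + B′| = t(|A′| + |B′| + ρ) − t|H|` — the stabilizer bound (9).
[cite: Grynkiewicz2010, §2 Step 1] -/
theorem step_one (h : Str t A B A' B') (hA' : A'.Nonempty) (hB' : B'.Nonempty)
    (hsA : Sat A A' (A' + B').addStab) (hsB : Sat B B' (A' + B').addStab) :
    t * (A.card + B.card) ≤ NS t A B + t * t ∨
    ((A' + B').card + (A' + B').addStab.card =
        (A' + (A' + B').addStab).card + (B' + (A' + B').addStab).card ∧
      t + 1 + (((A' + (A' + B').addStab).card - A'.card) + ((B' + (A' + B').addStab).card - B'.card)) ≤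
        (A' + B').addStab.card ∧
      t * (A' + B').card + ((A \ A').card + (B \ B').card) *
        ((A' + B').addStab.card -
          (((A' + (A' + B').addStab).card - A'.card) + ((B' + (A' + B').addStab).card - B'.card))) ≤
        NS t A B) := by
  set H := (A' + B').addStab with hH
  set l := (A \ A').card + (B \ B').card with hl
  set ρ := ((A' + H).card - A'.card) + ((B' + H).card - B'.card) with hρ
  have hSne : (A' + B').Nonempty := hA'.add hB'
  have hHne : H.Nonempty := hSne.addStab
  have hper : A' + B' + H = A' + B' := add_addStab _
  have hcA := card_sdiff_add_card_eq_card h.1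
  have hcB := card_sdiff_add_card_eq_card h.2.1
  have hlt : l + 1 ≤ t := h.2.2.1
  have hNS := h.NS_eq
  -- Case 1: `|A' + B'| ≥ |A'| + |B'| - 1`
  by_cases hbig : A'.card + B'.card ≤ (A' + B').card + 1
  · left
    have h1 : t * (A' + B').card ≤ NS t A B := by rw [hNS]; exact Nat.le_add_right _ _
    have h2 : t * (A'.card + B'.card) ≤ t * (A' + B').card + t := by
      calc t * (A'.card + B'.card) ≤ t * ((A' + B').card + 1) := Nat.mul_le_mul_left t hbig
        _ = t * (A' + B').card + t := by ring
    have h3 : A.card + B.card = A'.card + B'.card + l := by rw [hl]; omega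
    have h4 : t * l + t ≤ t * t := by
      calc t * l + t = t * (l + 1) := by ring
        _ ≤ t * t := Nat.mul_le_mul_left t hlt
    rw [h3, mul_add]
    omega
  · rw [not_le] at hbig
    have htight := kneser_eq_of_card_add_lt hA' hB' (by omega)
    rw [← hH] at htight
    have hρA : A'.card ≤ (A' + H).card := card_le_card_add_addStab hSne A'
    have hρB : B'.card ≤ (B' + H).card := card_le_card_add_addStab hSne B'
    have hpairs : l * (H.card - ρ) ≤ ((A ×ˢ B).filter (fun p => p.1 + p.2 ∉ A' + B')).card :=
      pairs_outside_ge h.1 h.2.1 hA' hB' htight hsA hsB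
    have hHρ : ρ + 2 ≤ H.card := by omega
    have hsum : A.card + B.card = A'.card + B'.card + l := by rw [hl]; omega
    have hS' : (A' + B').card + H.card = A'.card + B'.card + ρ := by omega
    by_cases hsmall : H.card ≤ t + ρ
    · -- `|H| - ρ ≤ t`: the stabilizer bound degenerates to `t(|A|+|B|) - t²`, case (i)
      left
      obtain ⟨d, hd⟩ : ∃ d, H.card = ρ + d := ⟨H.card - ρ, by omega⟩
      have hdt : d ≤ t := by omega
      have hX : l * d ≤ ((A ×ˢ B).filter (fun p => p.1 + p.2 ∉ A' + B')).card := by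
        rw [hd, Nat.add_sub_cancel_left] at hpairs; exact hpairs
      have key : t * l + t * d ≤ l * d + t * t := by
        obtain ⟨e, rfl⟩ : ∃ e, t = d + e := ⟨t - d, by omega⟩
        nlinarith
      have e1 : t * (A' + B').card + t * H.card = t * A'.card + t * B'.card + t * ρ := by
        rw [← mul_add, hS']; ring
      have e2 : t * H.card = t * ρ + t * d := by rw [hd, mul_add]
      rw [hNS, hsum, mul_add, mul_add]
      linarith
    · right
      exact ⟨htight, by omega, by rw [hNS]; exact Nat.add_le_add_left hpairs _⟩

end StepOne

end Grynkiewicz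

end Literature.Combinatorics.Additive
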